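import Mathlib
import HarnessLib
import Literature.Barriers.Parity.SiegelZeroDichotomy
import Literature.NumberTheory.Sieve.LinearEquationsInPrimesTwinSystem
import Literature.NumberTheory.Sieve.SingularSeriesPairProofs
import Literature.NumberTheory.Sieve.HardyLittlewoodProofs
import Literature.NumberTheory.Sieve.ClusterComplexity

/-!
# Range–quality exchange: definitions (decomp-parity lens-5 g10 certificate «RangeQualityExchange»)

Vocabulary for `Theorems/RangeQualityExchange.lean` (helper for the uniformity leaf
`SiegelSpectrumSplit.UniformUpperGivenFixed`, stmt-Parity-26853, of route-Parity-SiegelSpectrumSplit):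

* `UniformUpperUpTo R` / `UniformLowerUpTo R` — the bare one-sided pair Hardy–Littlewood statement,
  uniform over even shifts `0 < h ≤ N` with `h ≤ R N` (the SHIFT-RANGE dial; the born leaves UU/UL are
  its full-range cell `R = id` under their conditionings);
* `RangeReachingZeros R` / `RangeReachingZerosFour R` — exceptional zeros whose Matomäki–Merikoski
  excess shift `2q` (deficit shift `q/2` on `4 ∣ q`) fits under the range `R` at an admissible scale;
* `QualityAbove B` / `QualityAboveFour B` — zeros of quality `η ≥ (log q)^B` infinitely often (the
  QUALITY dial of the record's band leaves H/L);
* `UnboundedSiegelZerosFour` — unbounded quality along `4 ∣ q`;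
* `UpperBlock` / `LowerBlock` — the one-sided uniform Green–Tao blocks (verbatim the conclusions of
  the born items `UpperGivenBoundedSiegel` / `LowerGivenBoundedSiegel`).

Definitions only; no statements. Kernel: HOME/decomp-parity-lens-5/g10/RangeQualityExchange.lean.
-/

open Finset Filter MeasureTheory
open scoped Topology ArithmeticFunction.vonMangoldt
open Literature.NumberTheory.Sieve Literature.Barriers.Parity

noncomputable section

namespace Summit.Parity.GeneralizedHardyLittlewood.RangeQualityExchange

/-- **Uniform UPPER pair Hardy–Littlewood up to shift range `R`**: for every `ε > 0`, eventually in
`N`, `∑_{n ≤ N} Λ(n)Λ(n+h) ≤ N𝔖(h) + εN` for all even shifts `0 < h ≤ N` with `h ≤ R N`.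
(ref. GreenTao2010, Conjecture 1.2) -/
def UniformUpperUpTo (R : ℕ → ℝ) : Prop :=
  ∀ ε : ℝ, 0 < ε → ∃ N₀ : ℕ, ∀ N : ℕ, N₀ ≤ N → ∀ h : ℕ, h ≠ 0 → Even h → h ≤ N → (h : ℝ) ≤ R N →
    (∑ n ∈ Icc 1 N, Λ n * Λ (n + h)) - (N : ℝ) * goldbachSingularSeries h ≤ ε * N

/-- **Uniform LOWER pair Hardy–Littlewood up to shift range `R`**: for every `ε > 0`, eventually in
`N`, `∑_{n ≤ N} Λ(n)Λ(n+h) ≥ N𝔖(h) - εN` for all even shifts `0 < h ≤ N` with `h ≤ R N`.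
(ref. GreenTao2010, Conjecture 1.2) -/
def UniformLowerUpTo (R : ℕ → ℝ) : Prop :=
  ∀ ε : ℝ, 0 < ε → ∃ N₀ : ℕ, ∀ N : ℕ, N₀ ≤ N → ∀ h : ℕ, h ≠ 0 → Even h → h ≤ N → (h : ℝ) ≤ R N →
    (N : ℝ) * goldbachSingularSeries h - (∑ n ∈ Icc 1 N, Λ n * Λ (n + h)) ≤ ε * N

/-- **Range-reaching zeros** (upper side): for every `δ > 0` there are, at arbitrarily large conductors
and qualities, Siegel zeros `(q, χ, η)` together with an integer scale exponent `V ≥ 10` inside the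
Matomäki–Merikoski window (`V log⁶η / η ≤ δ`) such that the excess shift `2q` lies within the range at
`N = q^V`: `2q ≤ R(q^V)`. (ref. MatomakiMerikoski2023, Theorem 1.3) -/
def RangeReachingZeros (R : ℕ → ℝ) : Prop :=
  ∀ δ : ℝ, 0 < δ → ∀ (η₀ : ℝ) (q₀ : ℕ),
    ∃ (q : ℕ) (_ : NeZero q) (χ : DirichletCharacter ℂ q) (η : ℝ) (V : ℕ),
      q₀ ≤ q ∧ η₀ ≤ η ∧ IsSiegelZero χ η ∧ 10 ≤ V ∧ (V : ℝ) * Real.log η ^ 6 / η ≤ δ ∧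
        ((2 * q : ℕ) : ℝ) ≤ R (q ^ V)

/-- **Range-reaching zeros at conductors `4 ∣ q`** (lower side; the deficit shift is `q/2`).
(ref. MatomakiMerikoski2023, Theorem 1.3) -/
def RangeReachingZerosFour (R : ℕ → ℝ) : Prop :=
  ∀ δ : ℝ, 0 < δ → ∀ (η₀ : ℝ) (q₀ : ℕ),
    ∃ (q : ℕ) (_ : NeZero q) (χ : DirichletCharacter ℂ q) (η : ℝ) (V : ℕ),
      q₀ ≤ q ∧ η₀ ≤ η ∧ 4 ∣ q ∧ IsSiegelZero χ η ∧ 10 ≤ V ∧ (V : ℝ) * Real.log η ^ 6 / η ≤ δ ∧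
        ((q / 2 : ℕ) : ℝ) ≤ R (q ^ V)

/-- **Quality above `(log q)^B`**: Siegel zeros of primitive quadratic characters with quality
`η ≥ (log q)^B` recur at arbitrarily large conductors (`B = 0`: merely `η ≥ 10`; every `B`:
a sub-world of `UnboundedSiegelZeros`, `unboundedSiegelZeros_of_qualityAbove`). Its negation is the
polylog zero-free region "in quality form" of exponent `B`. (ref. TaoTeravainen2021, Definition 1.4) -/
def QualityAbove (B : ℝ) : Prop :=
  ∀ q₀ : ℕ, ∃ (q : ℕ) (_ : NeZero q) (χ : DirichletCharacter ℂ q) (η : ℝ),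
    q₀ ≤ q ∧ Real.log q ^ B ≤ η ∧ IsSiegelZero χ η

/-- `QualityAbove` along conductors `4 ∣ q` (the lower-side family). (ref. TaoTeravainen2021, Definition 1.4) -/
def QualityAboveFour (B : ℝ) : Prop :=
  ∀ q₀ : ℕ, ∃ (q : ℕ) (_ : NeZero q) (χ : DirichletCharacter ℂ q) (η : ℝ),
    q₀ ≤ q ∧ 4 ∣ q ∧ Real.log q ^ B ≤ η ∧ IsSiegelZero χ η

/-- Unbounded-quality Siegel zeros at conductors divisible by `4` (verbatim the record kernel's
`UnboundedSiegelZerosFour`). (ref. TaoTeravainen2021, Definition 1.4) -/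
def UnboundedSiegelZerosFour : Prop :=
  ∀ (η₀ : ℝ) (q₀ : ℕ), ∃ (q : ℕ) (_ : NeZero q) (χ : DirichletCharacter ℂ q) (η : ℝ),
    q₀ ≤ q ∧ η₀ ≤ η ∧ 4 ∣ q ∧ IsSiegelZero χ η

/-- The uniform UPPER half of Green–Tao's Conjecture 1.2 (same quantifier block, one-sided; verbatim
the conclusion of the record item `UpperGivenBoundedSiegel`). (ref. GreenTao2010, Conjecture 1.2) -/
def UpperBlock : Prop :=
  ∀ (d t L : ℕ), 1 ≤ d → 1 ≤ t → ∀ ε : ℝ, 0 < ε → ∃ N₀ : ℕ, ∀ N : ℕ, N₀ ≤ N →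
    ∀ Ψ : Fin t → AffLinForm d, IsNondegenerateSystem Ψ → affLinSize Ψ N ≤ L →
      ∀ K : Set (Fin d → ℝ), Convex ℝ K → K ⊆ realBox d N →
        vonMangoldtSum Ψ K N - archFactor Ψ K * singularProduct Ψ ≤ ε * (N : ℝ) ^ d

/-- The uniform LOWER half of Green–Tao's Conjecture 1.2 (verbatim the conclusion of the record item
`LowerGivenBoundedSiegel`). (ref. GreenTao2010, Conjecture 1.2) -/
def LowerBlock : Prop :=
  ∀ (d t L : ℕ), 1 ≤ d → 1 ≤ t → ∀ ε : ℝ, 0 < ε → ∃ N₀ : ℕ, ∀ N : ℕ, N₀ ≤ N →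
    ∀ Ψ : Fin t → AffLinForm d, IsNondegenerateSystem Ψ → affLinSize Ψ N ≤ L →
      ∀ K : Set (Fin d → ℝ), Convex ℝ K → K ⊆ realBox d N →
        archFactor Ψ K * singularProduct Ψ - vonMangoldtSum Ψ K N ≤ ε * (N : ℝ) ^ d

end Summit.Parity.GeneralizedHardyLittlewood.RangeQualityExchange
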